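import Mathlib
import Literature.Probability.Moments.CovarianceFreezing
import HarnessLib

/-!
# The footprint law below acceptance one half: `|Cov_π(A, B)| ≤ a b` for bounded witnesses

Honest framing: exact (Metropolis-corrected) sampling algorithms for lattice gauge theory; figures
of merit are autocorrelation/cost numbers at stated couplings and volumes; no continuum-physics
claim.

Venture `LatticeQCDFlow` (cell pub-lqcd), topic `TrivializingMaps`; FANOUT row 28 (theory-1),
THEORY-1 §36 (row 96g).  NEW WORK of the cell = one packaging corollary; the mathematics is the
Literature fact `Literature.Probability.Moments.abs_cov_le_of_osc` (Popoviciu 1935 /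
Bhatia–Davis 2000 + Cauchy–Schwarz, in oscillation form: `|∫ XY − ∫ X ∫ Y| ≤ ab/4` when the
values of `X`, `Y` lie within `a`, `b` of each other), cited by name and proved there.

* `abs_cov_le_mul_of_abs_le` — under ANY probability measure, measurable witnesses with
  `|A| ≤ a`, `|B| ≤ b` have `|∫ A B − ∫ A ∫ B| ≤ a b` (oscillations `≤ 2a`, `≤ 2b`);
* `abs_cov_density_le_mul_of_abs_le` — the same in the density form of THEOREM Q
  (`AcceptanceFootprint.abs_cov_le_of_meanAccept`): reference measure `μ`, target density
  `p ≥ 0` of unit mass, `π = p · μ`; NO acceptance hypothesis, no model, no factorisation.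

ROLE.  This is the UPPER half of the sharp acceptance–footprint function on `[0, ½]`: together
with `AcceptanceCurveFullMeasure.abs_cov_le_curve_of_meanAccept` (row 96e: `4 acc (1 - acc) a b`
for `acc ≥ ½`) the law `|Cov| ≤ (1 - ((2 acc - 1)₊)²) · a b` holds in every setting of
THEOREM Q, and by `AcceptanceFootprintFloor.Sharp.one_le_of_law` /
`AcceptanceCurveSharp.Sharp.envelope_le_of_law` (row 96f) no acceptance-only law does better at
any `acc ∈ [0, 1]`.  NOT CLAIMED: anything else.  No `sorry`, no new axioms, no `def`.
-/

namespace Summit.Ventures.LatticeQCDFlow.TrivializingMaps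

open MeasureTheory Set
open scoped ENNReal NNReal

variable {X : Type*} [MeasurableSpace X]

/-- **`|Cov_π(A, B)| ≤ a b` FOR BOUNDED WITNESSES.**  Under any probability measure `π`,
measurable `A`, `B` with `|A| ≤ a`, `|B| ≤ b` pointwise satisfy
`|∫ A B ∂π - ∫ A ∂π · ∫ B ∂π| ≤ a b` — the Literature fact `abs_cov_le_of_osc` (Popoviciu +
Cauchy–Schwarz) with oscillations `2a`, `2b`.  (Sharp: `A = B = σ` a fair sign.) -/
theorem abs_cov_le_mul_of_abs_le (π : Measure X) [IsProbabilityMeasure π] {A B : X → ℝ}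
    (hAm : Measurable A) (hBm : Measurable B) {a b : ℝ} (hA : ∀ x, |A x| ≤ a)
    (hB : ∀ x, |B x| ≤ b) :
    |∫ x, A x * B x ∂π - (∫ x, A x ∂π) * ∫ x, B x ∂π| ≤ a * b := by
  obtain ⟨x₀⟩ := nonempty_of_isProbabilityMeasure π
  have ha : 0 ≤ a := (abs_nonneg _).trans (hA x₀)
  have hb : 0 ≤ b := (abs_nonneg _).trans (hB x₀)
  have hAK : ∀ x, |A x| ≤ max a b := fun x => (hA x).trans (le_max_left _ _)
  have hBK : ∀ x, |B x| ≤ max a b := fun x => (hB x).trans (le_max_right _ _)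
  have hAo : ∀ x x', |A x - A x'| ≤ 2 * a := fun x x' =>
    (abs_sub _ _).trans (by linarith [hA x, hA x'])
  have hBo : ∀ x x', |B x - B x'| ≤ 2 * b := fun x x' =>
    (abs_sub _ _).trans (by linarith [hB x, hB x'])
  have h := Literature.Probability.Moments.abs_cov_le_of_osc (μ := π) hAm.aestronglyMeasurable
    hBm.aestronglyMeasurable (by linarith) (by linarith) hAK hBK hAo hBo
  exact h.trans_eq (by ring)

variable (μ : Measure X)

/-- **THE LAW BELOW ONE HALF, density form of THEOREM Q.**  Reference measure `μ`, target
density `p ≥ 0` (integrable, `∫ p ∂μ = 1`), `π = p · μ`; measurable witnesses with `|A| ≤ a`,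
`|B| ≤ b`: `|Cov_π(A, B)| ≤ a b` — with NO acceptance hypothesis.  With row 96e this gives the
law `(1 - ((2 acc - 1)₊)²) · a b` on all of `[0, 1]`; `Sharp.one_le_of_law` and row 96f show
that no acceptance-only law beats it. -/
theorem abs_cov_density_le_mul_of_abs_le {p : X → ℝ} (hp0 : ∀ x, 0 ≤ p x)
    (hpi : Integrable p μ) (hp1 : ∫ x, p x ∂μ = 1) {A B : X → ℝ} (hAm : Measurable A)
    (hBm : Measurable B) {a b : ℝ} (hA : ∀ x, |A x| ≤ a) (hB : ∀ x, |B x| ≤ b) :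
    |∫ x, A x * B x ∂(μ.withDensity fun x => ENNReal.ofReal (p x))
        - (∫ x, A x ∂(μ.withDensity fun x => ENNReal.ofReal (p x)))
          * ∫ x, B x ∂(μ.withDensity fun x => ENNReal.ofReal (p x))| ≤ a * b := by
  haveI : IsProbabilityMeasure (μ.withDensity fun x => ENNReal.ofReal (p x)) := by
    refine ⟨?_⟩
    rw [withDensity_apply _ MeasurableSet.univ, Measure.restrict_univ,
      ← ofReal_integral_eq_lintegral_ofReal hpi (ae_of_all _ hp0), hp1, ENNReal.ofReal_one]
  exact abs_cov_le_mul_of_abs_le _ hAm hBm hA hB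

end Summit.Ventures.LatticeQCDFlow.TrivializingMaps
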